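import Summits.QuantumFields.YangMills.Theorems.ColdStartUniversalityLatticeLangevinTwoTimeLaw
import Summits.QuantumFields.YangMills.Theorems.ColdStartUniversalityLatticeLangevinExpMixing
import HarnessLib

/-!
# Route `ColdStartUniversality` (fixed-cut-off SZZ dynamics): ★★★ TIME-LIKE DECORRELATION ALONG EVERY STRONG SOLUTION —
# `|E[F(U_s)·G(U_(s+t))] − E[F(U_s)]·μ_(β')(G)| ≤ C·e^(−ct)`, every coupling, every start, every bounded measurable `F, G`

Helper file (seat `ym-line-csu-p1`, g33; `--supports stmt-QuantumFields-24809`).  The Markov property of strong solutions (files 44–45,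
`integral_mul_comp_add_eq_integral_mul_transition`: `E[F(U_s)G(U_(s+t))] = E[F(U_s)·(κ_t G)(U_s)]`) combined with the every-start exponential
mixing of THE transition kernels (Harris' theorem at fixed cut-off, `exp_mixing_szz`: `|κ_t G(y) − μ_(β')(G)| ≤ C e^(−ct)` for `|G| ≤ 1`, every `y`)
gives the TEMPORAL counterpart of the space-like light cone (files 43/46): along every strong solution of the SU(2) SZZ dynamics from a
deterministic start on ANY probability space — in particular the COLD START of the route — two bounded measurable observables read at times
`s` and `s + t` decorrelate exponentially in the time separation `t`, uniformly in `s`: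
* ★ `abs_transition_sub_wilson_le_exp` — kernel form of `exp_mixing_szz`: `|∫ G dκ_t(y) − ∫ G dμ_(β')| ≤ C e^(−ct)` for every realising family;
* ★★★ `abs_twoTime_sub_mul_wilson_le_exp` — `|E[F(U_s)G(U_(s+t))] − E[F(U_s)]·μ_(β')(G)| ≤ C·e^(−ct)`;
* ★★★ `abs_twoTime_covariance_le_exp` — `|E[F(U_s)G(U_(s+t))] − E[F(U_s)]·E[G(U_(s+t))]| ≤ 2C·e^(−ct)`;
* ★★ `abs_twoTime_sub_wilson_mul_wilson_le_exp` — asymptotic independence AND equilibration: `|E[F(U_s)G(U_(s+t))] − μ_(β')(F)·μ_(β')(G)| ≤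
  C·(e^(−cs) + e^(−ct))` (the two-time law converges to `μ_(β') ⊗ μ_(β')` as `s, t → ∞`);
* ★★ `abs_twoTime_centered_le_exp` — for the CENTRED observable `G − μ_(β')(G)`: `|E[(F(U_s))·(G(U_(s+t)) − μG)]| ≤ C e^(−ct)` with `|F| ≤ 1` — the
  integrand of the variance of time averages (mean-square ergodic theorem, next file).
Constants `C, c > 0` depend on `L, β'` (Harris/Doeblin at fixed cut-off; every coupling).  THEOREMS ONLY, no definition, no sorry; [folklore].
HONEST FRAMING: fixed cut-off, volume-dependent constants; `UniformColdStartMixing` (24809) is NOT restated; no crux, rung or summit statement is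
proved; the Yang–Mills mass gap is NOT proved.
-/

set_option autoImplicit false

noncomputable section

namespace Summit.QuantumFields.YangMills.Theorems.ColdStartUniversality

open MeasureTheory ProbabilityTheory Filter Topology
open scoped NNReal ENNReal BigOperators
open Literature Literature.Probability.Process Literature.MathematicalPhysics.QuantumFieldTheory
open Literature.MathematicalPhysics.QuantumLattice (fundamentalRep fundamentalLatticeRep continuous_fundamentalRep)

variable {L : ℕ} [NeZero L]

/-! ## §1. Every-start exponential mixing in kernel form -/

/-- ★ **Every-start exponential mixing of THE transition kernels** (kernel form of `exp_mixing_szz`): there are `C, c > 0` (depending on the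
torus size and the coupling) such that for every realising Markov kernel family `κ`, every bounded measurable `G` with `|G| ≤ 1`, every start
`y` and every lattice time `t`: `|∫ G dκ_t(y) − ∫ G dμ_(β')| ≤ C·e^(−ct)`. [cite: HairerMattingly2011, Theorems 1.2 and 1.3] -/
theorem abs_transition_sub_wilson_le_exp (L : ℕ) [NeZero L] (β' : ℝ) :
    ∃ C c : ℝ, 0 < C ∧ 0 < c ∧
      ∀ (κ : ℝ≥0 → Kernel (GaugeConfig 3 L (Matrix.specialUnitaryGroup (Fin 2) ℂ))
          (GaugeConfig 3 L (Matrix.specialUnitaryGroup (Fin 2) ℂ))) [∀ t, IsMarkovKernel (κ t)],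
        (∀ (t : ℝ≥0) (x : GaugeConfig 3 L (Matrix.specialUnitaryGroup (Fin 2) ℂ))
          (Ω : Type) [MeasurableSpace Ω] (P : Measure Ω) [IsProbabilityMeasure P]
          (W : ℝ≥0 → Ω → (Edge 3 L × NoiseIdx 2 → ℝ)) (hW : IsFlatBrownian W P)
          (U : ℝ≥0 → Ω → GaugeConfig 3 L (Matrix.specialUnitaryGroup (Fin 2) ℂ)),
          (∀ ω, U 0 ω = x) →
          (latticeLangevinDynamics (fundamentalLatticeRep 2) β').IsSolution (fundamentalRep (Fin 2))
            hW.natFiltration P W U →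
          κ t x = P.map (U t)) →
        ∀ (G : GaugeConfig 3 L (Matrix.specialUnitaryGroup (Fin 2) ℂ) → ℝ), Measurable G → (∀ z, |G z| ≤ 1) →
        ∀ (t : ℝ≥0) (y : GaugeConfig 3 L (Matrix.specialUnitaryGroup (Fin 2) ℂ)),
          |(∫ z, G z ∂(κ t y)) - ∫ z, G z ∂(wilsonMeasure (d := 3) (L := L) (fundamentalRep (Fin 2)) β')| ≤ C * Real.exp (-c * t) := by
  obtain ⟨C, c, hC, hc, h⟩ := exp_mixing_szz_map L β'
  refine ⟨C, c, hC, hc, fun κ _ hreal G hG hG1 t y => ?_⟩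
  haveI := isProbabilityMeasure_piWiener (Edge 3 L × NoiseIdx 2)
  have hWpi := isFlatBrownian_piWiener 3 L (NoiseIdx 2)
  obtain ⟨V, hV0, hV⟩ := solution_from_start hWpi β' y
  rw [hreal t y _ (Measure.pi fun _ : Edge 3 L × NoiseIdx 2 => preWienerMeasure) _ hWpi V hV0 hV]
  exact h y t G hG hG1 _ (Measure.pi fun _ : Edge 3 L × NoiseIdx 2 => preWienerMeasure) _ hWpi V hV0 hV

/-! ## §2. Two-time decorrelation along every strong solution -/

/-- ★★★ **Time-like decorrelation along every strong solution, every coupling.**  There are `C, c > 0` (depending on `L, β'`) such that for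
EVERY strong solution `U` of the SU(2) SZZ dynamics from a deterministic start on ANY probability space, all lattice times `s, t` and all bounded
measurable `F, G` with `|F|, |G| ≤ 1`:
`|E[F(U_s)·G(U_(s+t))] − E[F(U_s)]·∫ G dμ_(β')| ≤ C·e^(−ct)` — the Markov property (file 44) and every-start mixing (Harris). [folklore] -/
theorem abs_twoTime_sub_mul_wilson_le_exp (L : ℕ) [NeZero L] (β' : ℝ) :
    ∃ C c : ℝ, 0 < C ∧ 0 < c ∧
      ∀ (x : GaugeConfig 3 L (Matrix.specialUnitaryGroup (Fin 2) ℂ))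
        (Ω : Type) [MeasurableSpace Ω] (P : Measure Ω) [IsProbabilityMeasure P]
        (W : ℝ≥0 → Ω → (Edge 3 L × NoiseIdx 2 → ℝ)) (hW : IsFlatBrownian W P)
        (U : ℝ≥0 → Ω → GaugeConfig 3 L (Matrix.specialUnitaryGroup (Fin 2) ℂ)),
        (∀ ω, U 0 ω = x) →
        (latticeLangevinDynamics (fundamentalLatticeRep 2) β').IsSolution (fundamentalRep (Fin 2)) hW.natFiltration P W U →
        ∀ (s t : ℝ≥0) (F G : GaugeConfig 3 L (Matrix.specialUnitaryGroup (Fin 2) ℂ) → ℝ),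
          Measurable F → (∀ z, |F z| ≤ 1) → Measurable G → (∀ z, |G z| ≤ 1) →
          |(∫ ω, F (U s ω) * G (U (s + t) ω) ∂P) -
              (∫ ω, F (U s ω) ∂P) * ∫ z, G z ∂(wilsonMeasure (d := 3) (L := L) (fundamentalRep (Fin 2)) β')| ≤ C * Real.exp (-c * t) := by
  classical
  obtain ⟨C, c, hC, hc, h⟩ := abs_transition_sub_wilson_le_exp L β'
  refine ⟨C, c, hC, hc, fun x Ω _ P _ W hW U hU0 hU s t F G hF hF1 hG hG1 => ?_⟩
  obtain ⟨κ, hκM, -, hreal⟩ := exists_transitionKernel L β'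
  haveI := hκM
  have hmix := h κ hreal G hG hG1 t
  have hmU : ∀ u : ℝ≥0, Measurable (U u) := fun u => (hU.adapted u).mono (hW.natFiltration.le u) le_rfl
  have hZ : Measurable[hW.natFiltration s] fun ω => F (U s ω) := hF.comp (hU.adapted s)
  -- Markov property
  have hM := integral_mul_comp_add_eq_integral_mul_transition β' κ hreal x hW hU0 hU s t hZ (fun ω => hF1 _) hG hG1
  rw [hM]
  set m : ℝ := ∫ z, G z ∂(wilsonMeasure (d := 3) (L := L) (fundamentalRep (Fin 2)) β') with hm
  have hκGm : Measurable fun y => ∫ z, G z ∂(κ t y) := (hG.stronglyMeasurable.integral_kernel (κ := κ t)).measurable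
  have hκGb : ∀ y, |∫ z, G z ∂(κ t y)| ≤ 1 := fun y => by
    have hh := norm_integral_le_of_norm_le_const (μ := κ t y) (f := G) (C := 1)
      (Eventually.of_forall fun z => by simpa [Real.norm_eq_abs] using hG1 z)
    simpa [Real.norm_eq_abs] using hh
  have i1 : Integrable (fun ω => F (U s ω) * ∫ z, G z ∂(κ t (U s ω))) P :=
    (integrable_const (1 : ℝ)).mono' ((hF.comp (hmU s)).mul (hκGm.comp (hmU s))).aestronglyMeasurable
      (Eventually.of_forall fun ω => by
        rw [norm_mul, Real.norm_eq_abs, Real.norm_eq_abs]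
        exact mul_le_one₀ (hF1 _) (abs_nonneg _) (hκGb _))
  have i2 : Integrable (fun ω => F (U s ω) * m) P :=
    ((integrable_const (1 : ℝ)).mono' (hF.comp (hmU s)).aestronglyMeasurable
      (Eventually.of_forall fun ω => by simpa [Real.norm_eq_abs] using hF1 (U s ω))).mul_const m
  have hdiff : (∫ ω, F (U s ω) * ∫ z, G z ∂(κ t (U s ω)) ∂P) - (∫ ω, F (U s ω) ∂P) * m =
      ∫ ω, F (U s ω) * ((∫ z, G z ∂(κ t (U s ω))) - m) ∂P := by
    rw [← integral_mul_const, ← integral_sub i1 i2]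
    exact integral_congr_ae (ae_of_all _ fun ω => by ring)
  rw [hdiff]
  have hpt : ∀ ω, |F (U s ω) * ((∫ z, G z ∂(κ t (U s ω))) - m)| ≤ C * Real.exp (-c * t) := fun ω => by
    rw [abs_mul]
    calc |F (U s ω)| * |(∫ z, G z ∂(κ t (U s ω))) - m| ≤ 1 * (C * Real.exp (-c * t)) :=
          mul_le_mul (hF1 _) (hmix (U s ω)) (abs_nonneg _) zero_le_one
      _ = C * Real.exp (-c * t) := one_mul _
  have hh := norm_integral_le_of_norm_le_const (μ := P) (f := fun ω => F (U s ω) * ((∫ z, G z ∂(κ t (U s ω))) - m))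
    (C := C * Real.exp (-c * t)) (Eventually.of_forall fun ω => by rw [Real.norm_eq_abs]; exact hpt ω)
  simpa [Real.norm_eq_abs] using hh

/-- ★★★ **Exponential decay of the two-time covariance along every strong solution** (every coupling; `C, c` depend on `L, β'`): for `|F|, |G| ≤ 1`
bounded measurable and all `s, t`, `|E[F(U_s)G(U_(s+t))] − E[F(U_s)]·E[G(U_(s+t))]| ≤ 2C·e^(−ct)` — observables read at two times
decorrelate exponentially in the time separation, uniformly in the earlier time `s` and in the start. [folklore] -/
theorem abs_twoTime_covariance_le_exp (L : ℕ) [NeZero L] (β' : ℝ) :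
    ∃ C c : ℝ, 0 < C ∧ 0 < c ∧
      ∀ (x : GaugeConfig 3 L (Matrix.specialUnitaryGroup (Fin 2) ℂ))
        (Ω : Type) [MeasurableSpace Ω] (P : Measure Ω) [IsProbabilityMeasure P]
        (W : ℝ≥0 → Ω → (Edge 3 L × NoiseIdx 2 → ℝ)) (hW : IsFlatBrownian W P)
        (U : ℝ≥0 → Ω → GaugeConfig 3 L (Matrix.specialUnitaryGroup (Fin 2) ℂ)),
        (∀ ω, U 0 ω = x) →
        (latticeLangevinDynamics (fundamentalLatticeRep 2) β').IsSolution (fundamentalRep (Fin 2)) hW.natFiltration P W U →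
        ∀ (s t : ℝ≥0) (F G : GaugeConfig 3 L (Matrix.specialUnitaryGroup (Fin 2) ℂ) → ℝ),
          Measurable F → (∀ z, |F z| ≤ 1) → Measurable G → (∀ z, |G z| ≤ 1) →
          |(∫ ω, F (U s ω) * G (U (s + t) ω) ∂P) - (∫ ω, F (U s ω) ∂P) * (∫ ω, G (U (s + t) ω) ∂P)| ≤ 2 * C * Real.exp (-c * t) := by
  classical
  obtain ⟨C, c, hC, hc, h⟩ := abs_twoTime_sub_mul_wilson_le_exp L β'
  refine ⟨C, c, hC, hc, fun x Ω _ P _ W hW U hU0 hU s t F G hF hF1 hG hG1 => ?_⟩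
  set m : ℝ := ∫ z, G z ∂(wilsonMeasure (d := 3) (L := L) (fundamentalRep (Fin 2)) β') with hm
  have h1 := h x Ω P W hW U hU0 hU s t F G hF hF1 hG hG1
  -- the one-time law at time `s + t` with `F ≡ 1` at time `s + t` (take `s ↦ s + t`, `t ↦ 0`? simpler: `F := 1`)
  have h2 := h x Ω P W hW U hU0 hU s t (fun _ => (1 : ℝ)) G measurable_const (fun _ => by simp) hG hG1
  simp only [one_mul, integral_const, probReal_univ, smul_eq_mul] at h2
  have hmU : ∀ u : ℝ≥0, Measurable (U u) := fun u => (hU.adapted u).mono (hW.natFiltration.le u) le_rfl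
  have hEF : |∫ ω, F (U s ω) ∂P| ≤ 1 := by
    have hh := norm_integral_le_of_norm_le_const (μ := P) (f := fun ω => F (U s ω)) (C := 1)
      (Eventually.of_forall fun ω => by simpa [Real.norm_eq_abs] using hF1 (U s ω))
    simpa [Real.norm_eq_abs] using hh
  have key : (∫ ω, F (U s ω) * G (U (s + t) ω) ∂P) - (∫ ω, F (U s ω) ∂P) * (∫ ω, G (U (s + t) ω) ∂P) =
      ((∫ ω, F (U s ω) * G (U (s + t) ω) ∂P) - (∫ ω, F (U s ω) ∂P) * m) -
        (∫ ω, F (U s ω) ∂P) * ((∫ ω, G (U (s + t) ω) ∂P) - m) := by ring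
  rw [key]
  calc |((∫ ω, F (U s ω) * G (U (s + t) ω) ∂P) - (∫ ω, F (U s ω) ∂P) * m) - (∫ ω, F (U s ω) ∂P) * ((∫ ω, G (U (s + t) ω) ∂P) - m)|
      ≤ |(∫ ω, F (U s ω) * G (U (s + t) ω) ∂P) - (∫ ω, F (U s ω) ∂P) * m| + |(∫ ω, F (U s ω) ∂P) * ((∫ ω, G (U (s + t) ω) ∂P) - m)| :=
        abs_sub _ _
    _ ≤ C * Real.exp (-c * t) + 1 * (C * Real.exp (-c * t)) := by
        refine add_le_add h1 ?_
        rw [abs_mul]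
        exact mul_le_mul hEF h2 (abs_nonneg _) zero_le_one
    _ = 2 * C * Real.exp (-c * t) := by ring

/-- ★★ **Asymptotic independence and equilibration of the two-time law** (every coupling; `C, c` depend on `L, β'`): for `|F|, |G| ≤ 1` and all `s, t`,
`|E[F(U_s)G(U_(s+t))] − μ_(β')(F)·μ_(β')(G)| ≤ C·(e^(−cs) + e^(−ct))` — the joint law of `(U_s, U_(s+t))` converges to `μ_(β') ⊗ μ_(β')` as
`s, t → ∞`, from every deterministic start. [folklore] -/
theorem abs_twoTime_sub_wilson_mul_wilson_le_exp (L : ℕ) [NeZero L] (β' : ℝ) :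
    ∃ C c : ℝ, 0 < C ∧ 0 < c ∧
      ∀ (x : GaugeConfig 3 L (Matrix.specialUnitaryGroup (Fin 2) ℂ))
        (Ω : Type) [MeasurableSpace Ω] (P : Measure Ω) [IsProbabilityMeasure P]
        (W : ℝ≥0 → Ω → (Edge 3 L × NoiseIdx 2 → ℝ)) (hW : IsFlatBrownian W P)
        (U : ℝ≥0 → Ω → GaugeConfig 3 L (Matrix.specialUnitaryGroup (Fin 2) ℂ)),
        (∀ ω, U 0 ω = x) →
        (latticeLangevinDynamics (fundamentalLatticeRep 2) β').IsSolution (fundamentalRep (Fin 2)) hW.natFiltration P W U →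
        ∀ (s t : ℝ≥0) (F G : GaugeConfig 3 L (Matrix.specialUnitaryGroup (Fin 2) ℂ) → ℝ),
          Measurable F → (∀ z, |F z| ≤ 1) → Measurable G → (∀ z, |G z| ≤ 1) →
          |(∫ ω, F (U s ω) * G (U (s + t) ω) ∂P) -
              (∫ z, F z ∂(wilsonMeasure (d := 3) (L := L) (fundamentalRep (Fin 2)) β')) *
                ∫ z, G z ∂(wilsonMeasure (d := 3) (L := L) (fundamentalRep (Fin 2)) β')| ≤
            C * (Real.exp (-c * s) + Real.exp (-c * t)) := by
  classical
  obtain ⟨C, c, hC, hc, h⟩ := abs_twoTime_sub_mul_wilson_le_exp L β'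
  obtain ⟨C', c', hC', hc', h'⟩ := exp_mixing_szz L β'
  -- use the larger constant and the smaller rate
  refine ⟨max C C', min c c', lt_max_of_lt_left hC, lt_min hc hc', fun x Ω _ P _ W hW U hU0 hU s t F G hF hF1 hG hG1 => ?_⟩
  haveI : IsProbabilityMeasure (wilsonMeasure (d := 3) (L := L) (fundamentalRep (Fin 2)) β') :=
    isProbabilityMeasure_wilsonMeasure (d := 3) (L := L) (fundamentalRep (Fin 2)) (continuous_fundamentalRep (Fin 2)) β'
  set mF : ℝ := ∫ z, F z ∂(wilsonMeasure (d := 3) (L := L) (fundamentalRep (Fin 2)) β') with hmF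
  set mG : ℝ := ∫ z, G z ∂(wilsonMeasure (d := 3) (L := L) (fundamentalRep (Fin 2)) β') with hmG
  have h1 := h x Ω P W hW U hU0 hU s t F G hF hF1 hG hG1
  have h2 := h' x s F hF hF1 Ω P W hW U hU0 hU
  have hmG1 : |mG| ≤ 1 := by
    have hh := norm_integral_le_of_norm_le_const (μ := wilsonMeasure (d := 3) (L := L) (fundamentalRep (Fin 2)) β') (f := G) (C := 1)
      (Eventually.of_forall fun z => by simpa [Real.norm_eq_abs] using hG1 z)
    simpa [Real.norm_eq_abs] using hh
  have key : (∫ ω, F (U s ω) * G (U (s + t) ω) ∂P) - mF * mG =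
      ((∫ ω, F (U s ω) * G (U (s + t) ω) ∂P) - (∫ ω, F (U s ω) ∂P) * mG) + ((∫ ω, F (U s ω) ∂P) - mF) * mG := by ring
  rw [key]
  have hes : Real.exp (-c * (t : ℝ)) ≤ Real.exp (-(min c c') * (t : ℝ)) :=
    Real.exp_le_exp.2 (by nlinarith [min_le_left c c', NNReal.coe_nonneg t])
  have hes' : Real.exp (-c' * (s : ℝ)) ≤ Real.exp (-(min c c') * (s : ℝ)) :=
    Real.exp_le_exp.2 (by nlinarith [min_le_right c c', NNReal.coe_nonneg s])
  calc |((∫ ω, F (U s ω) * G (U (s + t) ω) ∂P) - (∫ ω, F (U s ω) ∂P) * mG) + ((∫ ω, F (U s ω) ∂P) - mF) * mG|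
      ≤ |(∫ ω, F (U s ω) * G (U (s + t) ω) ∂P) - (∫ ω, F (U s ω) ∂P) * mG| + |((∫ ω, F (U s ω) ∂P) - mF) * mG| := abs_add_le _ _
    _ ≤ C * Real.exp (-c * t) + C' * Real.exp (-c' * s) * 1 := by
        refine add_le_add h1 ?_
        rw [abs_mul]
        exact mul_le_mul h2 hmG1 (abs_nonneg _) (le_trans (abs_nonneg _) h2)
    _ ≤ max C C' * Real.exp (-(min c c') * t) + max C C' * Real.exp (-(min c c') * s) := by
        rw [mul_one]
        exact add_le_add (mul_le_mul (le_max_left _ _) hes (Real.exp_nonneg _) (le_trans hC.le (le_max_left _ _)))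
          (mul_le_mul (le_max_right _ _) hes' (Real.exp_nonneg _) (le_trans hC.le (le_max_left _ _)))
    _ = max C C' * (Real.exp (-(min c c') * s) + Real.exp (-(min c c') * t)) := by ring

/-- ★★ **The centred two-time product decays** (every coupling; `C, c` depend on `L, β'`): for `|F| ≤ 1`, `|G| ≤ 1` and all `s, t`,
`|E[F(U_s)·(G(U_(s+t)) − μ_(β')(G))]| ≤ C·e^(−ct)` — the integrand of the variance of time averages along the cold-start evolution. [folklore] -/
theorem abs_twoTime_centered_le_exp (L : ℕ) [NeZero L] (β' : ℝ) :
    ∃ C c : ℝ, 0 < C ∧ 0 < c ∧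
      ∀ (x : GaugeConfig 3 L (Matrix.specialUnitaryGroup (Fin 2) ℂ))
        (Ω : Type) [MeasurableSpace Ω] (P : Measure Ω) [IsProbabilityMeasure P]
        (W : ℝ≥0 → Ω → (Edge 3 L × NoiseIdx 2 → ℝ)) (hW : IsFlatBrownian W P)
        (U : ℝ≥0 → Ω → GaugeConfig 3 L (Matrix.specialUnitaryGroup (Fin 2) ℂ)),
        (∀ ω, U 0 ω = x) →
        (latticeLangevinDynamics (fundamentalLatticeRep 2) β').IsSolution (fundamentalRep (Fin 2)) hW.natFiltration P W U →
        ∀ (s t : ℝ≥0) (F G : GaugeConfig 3 L (Matrix.specialUnitaryGroup (Fin 2) ℂ) → ℝ),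
          Measurable F → (∀ z, |F z| ≤ 1) → Measurable G → (∀ z, |G z| ≤ 1) →
          |∫ ω, F (U s ω) * (G (U (s + t) ω) - ∫ z, G z ∂(wilsonMeasure (d := 3) (L := L) (fundamentalRep (Fin 2)) β')) ∂P| ≤
            C * Real.exp (-c * t) := by
  classical
  obtain ⟨C, c, hC, hc, h⟩ := abs_twoTime_sub_mul_wilson_le_exp L β'
  refine ⟨C, c, hC, hc, fun x Ω _ P _ W hW U hU0 hU s t F G hF hF1 hG hG1 => ?_⟩
  set m : ℝ := ∫ z, G z ∂(wilsonMeasure (d := 3) (L := L) (fundamentalRep (Fin 2)) β') with hm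
  have h1 := h x Ω P W hW U hU0 hU s t F G hF hF1 hG hG1
  have hmU : ∀ u : ℝ≥0, Measurable (U u) := fun u => (hU.adapted u).mono (hW.natFiltration.le u) le_rfl
  have i1 : Integrable (fun ω => F (U s ω) * G (U (s + t) ω)) P :=
    (integrable_const (1 : ℝ)).mono' ((hF.comp (hmU s)).mul (hG.comp (hmU _))).aestronglyMeasurable
      (Eventually.of_forall fun ω => by
        rw [norm_mul, Real.norm_eq_abs, Real.norm_eq_abs]
        exact mul_le_one₀ (hF1 _) (abs_nonneg _) (hG1 _))
  have i2 : Integrable (fun ω => F (U s ω) * m) P :=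
    ((integrable_const (1 : ℝ)).mono' (hF.comp (hmU s)).aestronglyMeasurable
      (Eventually.of_forall fun ω => by simpa [Real.norm_eq_abs] using hF1 (U s ω))).mul_const m
  have heq : ∫ ω, F (U s ω) * (G (U (s + t) ω) - m) ∂P = (∫ ω, F (U s ω) * G (U (s + t) ω) ∂P) - (∫ ω, F (U s ω) ∂P) * m := by
    rw [← integral_mul_const, ← integral_sub i1 i2]
    exact integral_congr_ae (ae_of_all _ fun ω => by ring)
  rw [heq]
  exact h1

end Summit.QuantumFields.YangMills.Theorems.ColdStartUniversality

end
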